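import Literature.NumberTheory.GaloisCohomology.Howard2004.PiAdicRefinement
import Literature.NumberTheory.GaloisCohomology.Howard2004.FiniteSingularNatural
import Literature.NumberTheory.EllipticCurves.TowerSaturatedCartesianScalarProofs
import Literature.NumberTheory.EllipticCurves.TowerLocalH1LiftExactProofs
import Literature.NumberTheory.EllipticCurves.TowerRefinementProofs
import Literature.NumberTheory.GaloisRepresentations.GaloisH1MapBijectiveUnramified
import HarnessLib

/-!
# H.3 for saturated level conditions, assembled on the `π`-adic refinement: the cartesian identity for the
# presentations `T^{(k)} ↠ T/π^iT` along `×π^{j-i}`, from the tower-internal identity on the refinement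
# (theorems only; no definition, no named fact, no `sorry`)

B. Howard, *The Heegner point Kolyvagin system*, Compositio Math. 140 (2004) (arXiv:1202.6340), Hypothesis H.3 (p. 7
L65–67) for the SATURATED structure `F_𝔮` (Def. 3.1.2; p. 16 L1–3: «follows from [MR04, Lemma 3.7.1] and the fact that
`F_𝔮` on `T_𝔮` is obtained by propagation from `V_𝔮`»).  The cell's division of labour (memo `HOME/p1/H3-CARTESIAN-PLAN`):
the `π`-adic refinement `G_a = H¹(K_v, T/π^aT)` of the local `p`-adic tower `H_j = H¹(K_v, T/p^jT)` (presentations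
`PiRefinementDatum.Level`, `.map`, p651732), the tower-internal cartesian identity on `G` along `×π^d`
(`Tower.comap_levelCondition_eq_of_liftable_smul`, p649092, fed by x10b-p1-w7's (L)/(E), `TowerLocalH1LiftExactProofs`),
and the cofinal bridge `H ≅ G∘(m·)` (`Tower.levelCondition_subtower_eq`, p651151; `Tower.map_levelCondition_eq`, p649092).

THIS FILE composes them, for an abstract datum `D : PiRefinementDatum K R N` at a finite place `v` with `e_j = m·j`:
given level-wise cores `C^H_j ≤ H_j`, `C^G_a ≤ G_a` with `H¹(map a b)(C^G_a) ≤ C^G_b` and `H¹(proj_j)(C^H_j) = C^G_{mj}`,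
and the tower-internal identity `(L^G_j).comap H¹(map i j) = L^G_i` (`i ≤ j`) as a HYPOTHESIS (`hcartG`, discharged by
w7's turnkey), it proves

* §1 functoriality of the local maps (`H¹(map a a) = id`, `H¹(map b c) ∘ H¹(map a b) = H¹(map a c)`, bijectivity of
  `ι_j = H¹(proj : T^{(j)} → Level (mj))`, naturality `ι ∘ red = H¹(map) ∘ ι`, `H¹(map (mk) i) ∘ ι_k = H¹(proj_i)`);
* §2 the bridge **`map_iota_levelCondition_eq`**: `(L^H_k).map ι_k = L^G_{mk}`, and
  **`map_projH_levelCondition_eq`**: `(L^H_k).map H¹(proj_i) = L^G_i` for `i ≤ mk`;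
* §3 **`map_projH_levelCondition_eq_comap`**: `(L^H_k).map H¹(proj_i) = ((L^H_k).map H¹(proj_j)).comap H¹(map i j)` for
  `i ≤ j ≤ mk` — the cartesian identity of H.3 for the presentations `(Level i, proj_i)` of `T^{(k)}/π^iT^{(k)}` and the
  `Quot`-morphism `×π^{j-i} = map i j` (`PiRefinementDatum.isQuotientBy_levelRep`, `map_proj`), i.e. the input `hcart` of
  `isCartesianOnQuotAt_of_forall_pow` (p650910) read on ONE chain, up to the ring-free transport
  `map_cohomologyMap_eq_comap_iff_of_bijective` to the level-ring presentations.

Cell `pub/bsd-print-x9`, shared μ-item of rows 9/10 (D1 road, `SatisfiesH.h3`); seat `bsd-line-x10b-p1-w6`.  No statement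
about elliptic curves or Selmer groups is made; BSD is not proved by any of this.

References: [Howard2004HeegnerKolyvagin] Def. 1.1.1–1.1.3, H.3, §1.6, Def. 3.1.2 (arXiv p. 5 L36–44 and L88–99, p. 7
L65–67, p. 12 L29–55, p. 15–16); [MazurRubinMemoirs2004] Lemma 3.7.1; [SerreGaloisCohomology1997] I §2.2, II §1.
-/

set_option autoImplicit false

noncomputable section

open Function NumberField IsDedekindDomain Field
open scoped NumberField ContRepresentation Classical

namespace Literature.NumberTheory.GaloisCohomology.Howard2004

open Literature.NumberTheory.GaloisRepresentations
open Literature.NumberTheory.GaloisRepresentations.DiscreteGaloisModule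
open Literature.NumberTheory.EllipticCurves

namespace PiRefinementDatum

variable {K : Type} [Field K] [NumberField K] {R : Type} [CommRing R] {N : ℕ → Type}
  [∀ k, AddCommGroup (N k)] [∀ k, Module R (N k)] [∀ k, TopologicalSpace (N k)] [∀ k, DiscreteTopology (N k)]
  (D : PiRefinementDatum K R N) (v : HeightOneSpectrum (𝓞 K))

/-! ## §0 The local maps (no definitions: the tree's `localIntertwining` of the datum's module maps) -/

/-- Equivariance of `map a b` at the place `v` (for `localIntertwining`). [cite: Howard2004HeegnerKolyvagin, Def. 1.1.3 (arXiv p. 5 L93–99)] -/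
theorem map_equivariant_toLocal (a b : ℕ) (σ : absoluteGaloisGroup (v.adicCompletion K)) (x : D.Level a) :
    (D.map a b).toAddMonoidHom (GaloisRep.toLocal v (D.levelRep a) σ x) =
      GaloisRep.toLocal v (D.levelRep b) σ ((D.map a b).toAddMonoidHom x) :=
  D.map_equivariant a b _ x

/-- Equivariance of `proj` at the place `v`. [cite: Howard2004HeegnerKolyvagin, Def. 1.1.3 (arXiv p. 5 L93–99)] -/
theorem proj_equivariant_toLocal {i k : ℕ} (h : D.host i ≤ k) (σ : absoluteGaloisGroup (v.adicCompletion K)) (x : N k) :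
    (D.proj h).toAddMonoidHom (GaloisRep.toLocal v (D.ρ k) σ x) =
      GaloisRep.toLocal v (D.levelRep i) σ ((D.proj h).toAddMonoidHom x) :=
  (D.isQuotientBy_levelRep h).equivariant _ x

/-- Equivariance of `red` at the place `v`. [cite: Howard2004HeegnerKolyvagin, §1.6 (arXiv p. 12 L29–55)] -/
theorem red_equivariant_toLocal {k k' : ℕ} (h : k ≤ k') (σ : absoluteGaloisGroup (v.adicCompletion K)) (x : N k') :
    (D.red h).toAddMonoidHom (GaloisRep.toLocal v (D.ρ k') σ x) =
      GaloisRep.toLocal v (D.ρ k) σ ((D.red h).toAddMonoidHom x) :=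
  D.red_equivariant h _ x

/-- `H¹(K_v, map a b)`. An `abbrev` of the tree's `localH1Map` (no new object). [cite: Howard2004HeegnerKolyvagin, Def. 1.1.3 (arXiv p. 5 L93–99)] -/
abbrev mapH (a b : ℕ) :
    galoisCohomology (GaloisRep.toLocal v (D.levelRep a)) 1 →+ galoisCohomology (GaloisRep.toLocal v (D.levelRep b)) 1 :=
  localH1Map (D.levelRep a) (D.levelRep b) v (D.map a b).toAddMonoidHom (D.map_equivariant_toLocal v a b)

/-- `H¹(K_v, proj)` for `host i ≤ k`. An `abbrev` of `localH1Map`. [cite: Howard2004HeegnerKolyvagin, Def. 1.1.3 (arXiv p. 5 L93–99)] -/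
abbrev projH {i k : ℕ} (h : D.host i ≤ k) :
    galoisCohomology (GaloisRep.toLocal v (D.ρ k)) 1 →+ galoisCohomology (GaloisRep.toLocal v (D.levelRep i)) 1 :=
  localH1Map (D.ρ k) (D.levelRep i) v (D.proj h).toAddMonoidHom (D.proj_equivariant_toLocal v h)

/-- `H¹(K_v, red)` for `k ≤ k'`. An `abbrev` of `localH1Map`. [cite: Howard2004HeegnerKolyvagin, §1.6 (arXiv p. 12 L29–55)] -/
abbrev redH {k k' : ℕ} (h : k ≤ k') :
    galoisCohomology (GaloisRep.toLocal v (D.ρ k')) 1 →+ galoisCohomology (GaloisRep.toLocal v (D.ρ k)) 1 :=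
  localH1Map (D.ρ k') (D.ρ k) v (D.red h).toAddMonoidHom (D.red_equivariant_toLocal v h)

/-! ## §1 Functoriality of the local maps -/

/-- (hid on `H¹`) `H¹(map a a) = id`. [cite: SerreGaloisCohomology1997, Ch. I §2.2] -/
theorem mapH_self (a : ℕ) (c : galoisCohomology (GaloisRep.toLocal v (D.levelRep a)) 1) : D.mapH v a a c = c :=
  Tower.map_apply_eq_self_of_forall_apply_eq _ (D.map_self a) c

/-- (hcomp on `H¹`) `H¹(map b c) ∘ H¹(map a b) = H¹(map a c)` for `c ≤ b ≤ a`. [cite: SerreGaloisCohomology1997, Ch. I §2.2] -/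
theorem mapH_mapH_of_le {a b c : ℕ} (hcb : c ≤ b) (hba : b ≤ a)
    (x : galoisCohomology (GaloisRep.toLocal v (D.levelRep a)) 1) :
    D.mapH v b c (D.mapH v a b x) = D.mapH v a c x :=
  galoisCohomology.map_map_of_comp_apply _ _ _ (fun w => (D.map_map_of_le hcb hba w).symm) x

/-- `H¹(map (i+d) i) ∘ H¹(proj_{i+d}) = H¹(proj_i)` on a common host level `k` (reductions commute with the presentations).
[cite: Howard2004HeegnerKolyvagin, Def. 1.1.3 (arXiv p. 5 L93–99)] -/
theorem mapH_projH {i j k : ℕ} (hij : i ≤ j) (hi : D.host i ≤ k) (hj : D.host j ≤ k)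
    (x : galoisCohomology (GaloisRep.toLocal v (D.ρ k)) 1) :
    D.mapH v j i (D.projH v hj x) = D.projH v hi x :=
  galoisCohomology.map_map_of_comp_apply _ _ _ (fun n => by
    change D.proj hi n = D.map j i (D.proj hj n)
    rw [D.map_proj j i hj hi, Nat.sub_eq_zero_of_le hij, pow_zero, one_smul]) x

/-- Naturality `H¹(proj) ∘ H¹(red) = H¹(proj)` (two hosts). [cite: Howard2004HeegnerKolyvagin, §1.6 (arXiv p. 12 L29–55)] -/
theorem projH_redH {i k k' : ℕ} (h : D.host i ≤ k) (h' : k ≤ k')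
    (x : galoisCohomology (GaloisRep.toLocal v (D.ρ k')) 1) :
    D.projH v h (D.redH v h' x) = D.projH v (h.trans h') x :=
  galoisCohomology.map_map_of_comp_apply _ _ _ (fun n => (D.proj_red h h' n).symm) x

omit [NumberField K] in
/-- **`proj : T^{(k)} → Level t` is bijective when `e_k = t`** (`ker proj = π^{e_k} · T^{(k)} = ker (red refl) = 0`).
[cite: Howard2004HeegnerKolyvagin, §1.6 (arXiv p. 12 L29–55: T/𝔪^{e_k} read in two cofinal systems)] -/
theorem proj_bijective {k t : ℕ} (h : D.host t ≤ k) (het : D.e k = t) : Bijective (D.proj h) := by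
  refine ⟨?_, D.proj_surjective h⟩
  intro x y hxy
  rw [← sub_eq_zero] at hxy ⊢
  have hmem : x - y ∈ LinearMap.ker (D.proj h) := by
    rw [LinearMap.mem_ker, map_sub]
    exact hxy
  rw [D.ker_proj h, ← het] at hmem
  have hmem' : x - y ∈ LinearMap.ker (D.red (le_refl k)) := by
    rw [D.ker_red]
    exact hmem
  rwa [LinearMap.mem_ker, D.red_refl] at hmem'

/-- **`ι_k = H¹(proj : T^{(k)} → Level t)` is bijective when `e_k = t`** (`H¹` of an equivariant bijection).
[cite: Howard2004HeegnerKolyvagin, §1.6 (arXiv p. 12 L29–55)] [cite: SerreGaloisCohomology1997, Ch. I §2.2] -/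
theorem projH_bijective {k t : ℕ} (h : D.host t ≤ k) (het : D.e k = t) : Bijective (D.projH v h) :=
  galoisCohomology.map_one_bijective_of_bijective _ (D.proj_bijective h het)

/-! ## §2 The bridge: `p`-adic level conditions are `π`-adic level conditions -/

variable (p : ℕ) {m : ℕ} (hhost : ∀ j, D.host (m * j) ≤ j)
  (CP : ∀ j, AddSubgroup (galoisCohomology (GaloisRep.toLocal v (D.ρ j)) 1))
  (CG : ∀ a, AddSubgroup (galoisCohomology (GaloisRep.toLocal v (D.levelRep a)) 1))

/-- **`(L^H_k).map ι_k = L^{G∘(m·)}_k`**: the `p`-adic tower `(H¹(K_v, T^{(j)}), H¹(red))` is isomorphic, level by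
level along the bijections `ι_j`, to the sub-tower of `m`-th levels of the `π`-adic refinement (x10b-p1-w6
`Tower.map_levelCondition_eq`). [cite: Howard2004HeegnerKolyvagin, §1.6 (arXiv p. 12 L29–55)] [cite: SerreGaloisCohomology1997, Ch. I §2.2] -/
theorem map_iota_levelCondition_eq_subtower (he : ∀ j, D.e j = m * j)
    (hCPG : ∀ j, (CP j).map (D.projH v (hhost j)) = CG (m * j)) (k : ℕ) :
    (Tower.levelCondition (fun j ↦ D.redH v (Nat.le_succ j)) p CP k).map (D.projH v (hhost k)) =
      Tower.levelCondition (H := fun j ↦ galoisCohomology (GaloisRep.toLocal v (D.levelRep (m * j))) 1)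
        (fun j ↦ D.mapH v (m * j + m) (m * j)) p (fun j ↦ CG (m * j)) k := by
  refine Tower.map_levelCondition_eq (fun j ↦ D.redH v (Nat.le_succ j))
    (H' := fun j ↦ galoisCohomology (GaloisRep.toLocal v (D.levelRep (m * j))) 1)
    (fun j ↦ D.mapH v (m * j + m) (m * j)) (fun j ↦ D.projH v (hhost j)) (fun j x ↦ ?_)
    (fun j ↦ D.projH_bijective v (hhost j) (he j)) p CP (fun j ↦ CG (m * j)) hCPG k
  -- naturality: `ι_j (red x) = H¹(map (m(j+1)) (mj)) (ι_{j+1} x)`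
  rw [D.projH_redH v]
  exact (D.mapH_projH v (Nat.mul_le_mul_left m (Nat.le_succ j)) ((hhost j).trans (Nat.le_succ j))
    (hhost (j + 1)) x).symm

/-- **`(L^H_k).map ι_k = L^G_{mk}`** (the previous identity composed with x10b-p1-w7's cofinal-sub-tower bridge
`Tower.levelCondition_subtower_eq`). [cite: Howard2004HeegnerKolyvagin, §1.6 and Def. 3.1.2 (arXiv p. 12 L29–55, p. 15 L99–108)] -/
theorem map_iota_levelCondition_eq (hm : 1 ≤ m) (he : ∀ j, D.e j = m * j)
    (hCG : ∀ a b, b ≤ a → ∀ w ∈ CG a, D.mapH v a b w ∈ CG b)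
    (hCPG : ∀ j, (CP j).map (D.projH v (hhost j)) = CG (m * j)) (k : ℕ) :
    (Tower.levelCondition (fun j ↦ D.redH v (Nat.le_succ j)) p CP k).map (D.projH v (hhost k)) =
      Tower.levelCondition (fun a ↦ D.mapH v (a + 1) a) p CG (m * k) := by
  rw [D.map_iota_levelCondition_eq_subtower v p hhost CP CG he hCPG k]
  exact Tower.levelCondition_subtower_eq (fun a b ↦ D.mapH v a b) (fun a w ↦ D.mapH_self v a w)
    (fun a b c hcb hba w ↦ D.mapH_mapH_of_le v hcb hba w) hm p CG hCG k

/-- The level-`i` condition of the refinement is the image of the level-`t` condition under `H¹(map t i)`, `i ≤ t`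
(x10b-p1-w6 `Tower.map_redIter_levelCondition` with x10b-p1-w7 `Tower.redIter_eq_map`).
[cite: Howard2004HeegnerKolyvagin, Def. 1.1.3 (arXiv p. 5 L93–99: propagation is functorial over Quot(T))] -/
theorem map_mapH_levelCondition_eq {i t : ℕ} (hit : i ≤ t) :
    (Tower.levelCondition (fun a ↦ D.mapH v (a + 1) a) p CG t).map (D.mapH v t i) =
      Tower.levelCondition (fun a ↦ D.mapH v (a + 1) a) p CG i := by
  obtain ⟨d, rfl⟩ := Nat.exists_eq_add_of_le hit
  rw [← Tower.map_redIter_levelCondition (fun a ↦ D.mapH v (a + 1) a) p CG i d]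
  congr 1
  refine AddMonoidHom.ext fun y => ?_
  exact (Tower.redIter_eq_map (fun a ↦ GaloisRep.toLocal v (D.levelRep a))
    (fun a b ↦ localIntertwining (D.levelRep a) (D.levelRep b) v (D.map a b).toAddMonoidHom
      (D.map_equivariant_toLocal v a b))
    (fun a w ↦ D.map_self a w) (fun a b c hcb hba w ↦ D.map_map_of_le hcb hba w) i d y).symm

/-- **`(L^H_k).map H¹(proj_i) = L^G_i`** for `i ≤ mk`: the condition PROPAGATED from `T^{(k)}` to its quotient
`T^{(k)}/π^i` (presented by `Level i`) is the `π`-adic level-`i` condition.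
[cite: Howard2004HeegnerKolyvagin, Def. 1.1.3 and Def. 3.1.2 (arXiv p. 5 L93–99, p. 15 L99–108)] -/
theorem map_projH_levelCondition_eq (hm : 1 ≤ m) (he : ∀ j, D.e j = m * j)
    (hCG : ∀ a b, b ≤ a → ∀ w ∈ CG a, D.mapH v a b w ∈ CG b)
    (hCPG : ∀ j, (CP j).map (D.projH v (hhost j)) = CG (m * j)) {k i : ℕ} (hik : i ≤ m * k) (hi : D.host i ≤ k) :
    (Tower.levelCondition (fun j ↦ D.redH v (Nat.le_succ j)) p CP k).map (D.projH v hi) =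
      Tower.levelCondition (fun a ↦ D.mapH v (a + 1) a) p CG i := by
  have hfac : D.projH v hi = (D.mapH v (m * k) i).comp (D.projH v (hhost k)) :=
    AddMonoidHom.ext fun x ↦ (D.mapH_projH v hik hi (hhost k) x).symm
  rw [hfac, ← AddSubgroup.map_map, D.map_iota_levelCondition_eq v p hhost CP CG hm he hCG hCPG k,
    D.map_mapH_levelCondition_eq v p CG hik]

/-! ## §3 The cartesian identity for the presentations `T^{(k)} ↠ T^{(k)}/π^i` -/

/-- **H.3 for the saturated level condition, on the `π`-adic chain of presentations.**  Given the tower-internal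
cartesian identity on the refinement `(L^G_j).comap H¹(map i j) = L^G_i` (`i ≤ j`; x10b-p1-w7's turnkey on the datum's
two-index family), for `i ≤ j ≤ mk`:
`(L^H_k).map H¹(proj_i) = ((L^H_k).map H¹(proj_j)).comap H¹(map i j)` — the condition propagated from `T^{(k)}` to
`T^{(k)}/π^i` is the preimage under the `Quot`-morphism `×π^{j-i}` of the one propagated to `T^{(k)}/π^j` (Def. 1.1.2,
the input `hcart` of `isCartesianOnQuotAt_of_forall_pow` on the chain `PiRefinementDatum.isQuotientBy_levelRep`).
[cite: Howard2004HeegnerKolyvagin, H.3 with Def. 1.1.2–1.1.3 and Def. 3.1.2 (arXiv p. 7 L65–67, p. 5 L88–99, p. 16 L1–3)]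
[cite: MazurRubinMemoirs2004, Lemma 3.7.1] -/
theorem map_projH_levelCondition_eq_comap (hm : 1 ≤ m) (he : ∀ j, D.e j = m * j)
    (hCG : ∀ a b, b ≤ a → ∀ w ∈ CG a, D.mapH v a b w ∈ CG b)
    (hCPG : ∀ j, (CP j).map (D.projH v (hhost j)) = CG (m * j))
    (hcartG : ∀ i j, i ≤ j → (Tower.levelCondition (fun a ↦ D.mapH v (a + 1) a) p CG j).comap (D.mapH v i j) =
      Tower.levelCondition (fun a ↦ D.mapH v (a + 1) a) p CG i)
    {k i j : ℕ} (hij : i ≤ j) (hjk : j ≤ m * k) (hi : D.host i ≤ k) (hj : D.host j ≤ k) :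
    (Tower.levelCondition (fun j ↦ D.redH v (Nat.le_succ j)) p CP k).map (D.projH v hi) =
      ((Tower.levelCondition (fun j ↦ D.redH v (Nat.le_succ j)) p CP k).map (D.projH v hj)).comap (D.mapH v i j) := by
  rw [D.map_projH_levelCondition_eq v p hhost CP CG hm he hCG hCPG (hij.trans hjk) hi,
    D.map_projH_levelCondition_eq v p hhost CP CG hm he hCG hCPG hjk hj, hcartG i j hij]

/-- The hypothesis `hcartG` in the `(i, i+d)` indexing of the turnkeys. [cite: Howard2004HeegnerKolyvagin, H.3 (arXiv p. 7 L65–67)] -/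
theorem hcartG_of_add
    (h : ∀ i d, (Tower.levelCondition (fun a ↦ D.mapH v (a + 1) a) p CG (i + d)).comap (D.mapH v i (i + d)) =
      Tower.levelCondition (fun a ↦ D.mapH v (a + 1) a) p CG i) (i j : ℕ) (hij : i ≤ j) :
    (Tower.levelCondition (fun a ↦ D.mapH v (a + 1) a) p CG j).comap (D.mapH v i j) =
      Tower.levelCondition (fun a ↦ D.mapH v (a + 1) a) p CG i := by
  obtain ⟨d, rfl⟩ := Nat.exists_eq_add_of_le hij
  exact h i d

end PiRefinementDatum

end Literature.NumberTheory.GaloisCohomology.Howard2004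

end
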